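import Mathlib
import HarnessLib
import Summits.Ventures.LatticeQCDFlow.Exactness.NCMCGeneralSpaceGammaMethodStudentizedCLT
import Summits.Ventures.LatticeQCDFlow.Exactness.NCMCGeneralSpaceOccupancyChainCoverage

/-!
# With scorer A's Γ-method `τ̂` in place of `τ̄`, the reported intervals are ASYMPTOTICALLY EXACT: `P{|√n (p̂_n − π(A))/√(2 τ̂_n p̂_n(1 − p̂_n))| ≤ z} → N(0,1)([−z,z])` for every event of a chain with a Doeblin power, and `P_{δ_z₀}{|√n (dF_occ,n − ΔF) √(p̂_n(1 − p̂_n)/(2 τ̂_n))| ≤ z} → N(0,1)([−z,z])` for the NCMC lane from EVERY initial state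

HONEST FRAMING: exact (Metropolis-corrected) sampling algorithms for lattice gauge theory;
figures of merit are autocorrelation/cost numbers at stated couplings and volumes; no
continuum-physics claim.

Venture `LatticeQCDFlow` (cell pub-lqcd), topic `Exactness`; FANOUT row 13 (`eng-snf`, GEN-20).
NEW WORK of the cell, not a published result; no definition is introduced; nothing is cited as a
fact.  GEN-19 proved that the event-frequency interval `p̂_n ± z √(2 τ̄ p̂_n(1 − p̂_n)/n)`
(`NCMCGeneralSpaceIntervalCoverage.lean`) and the NCMC lane's reported
`dF_occ ± z √(2 τ̄/(n p̂(1 − p̂)))` (`NCMCGeneralSpaceOccupancyChainCoverage.lean`) have asymptotic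
coverage `N(0, τ_int/τ̄)([−z, z])` — at least nominal iff `τ̄ ≥ τ_int`, and listed "a consistent
estimator of `τ_int(ρ_occ)` (with it, coverage would be exactly nominal)" as NOT typed.  THIS FILE
puts scorer A's Γ-method estimate `τ̂_n = tauIntWindow (rhoHat y n) W_n` of the SAME run
(`y_i = 1_A(X_i)`, deterministic windows `W_n → ∞`, `W_n³/n → 0`) in place of `τ̄`: for a 0/1 series
`Γ̂_n(0) = p̂_n(1 − p̂_n)` exactly, so `2 τ̂_n p̂_n(1 − p̂_n)` IS the Γ-method variance statistic
`Γ̂_n(0) · 2 τ̂_n`, consistent for `σ²_{1_A} = 2 τ_int π(A)(1 − π(A))`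
(`NCMCGeneralSpaceGammaMethodConsistency.lean`); the studentized CLT of
`NCMCGeneralSpaceGammaMethodStudentizedCLT.lean` then gives coverage EXACTLY `N(0,1)([−z, z])` in the
limit, for every event of every chain with a Doeblin power from every initial law (§2), and — by the
`dF_occ` CLT of `NCMCGeneralSpaceOccupancyChainCLT.lean`, Slutsky with a product of plug-in factors —
for the NCMC lane's `dF_occ` interval from EVERY initial state under GEN-18's two-step certificate (§3).

## Content

§1 `TendstoInMeasure.mul_const_lim` (products of sequences converging in probability to constants),
`gammaHat_zero_indicator` (`Γ̂_N(0) = p̂_N(1 − p̂_N)` for an indicator series),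
`mul_inv_sqrt_mul_eq_sqrt_div` (`a (√(a t))⁻¹ = √(a/t)` for `a ≥ 0`), `measurable_tauIntWindow_rhoHat`.
§2 **`tendsto_measure_standardizedIndicator_gamma_le_of_nHit`** — `κ` Markov, `π` invariant,
`(nHit κ m)(z,·) ≥ ε ν`, `0 < π(A) < 1`, `τ_int(setACF κ π A) > 0`, windows as above, EVERY `μ₀`, `z > 0`:
`P_{μ₀}{|√n (p̂_n − π(A)) · (√(2 τ̂_n p̂_n(1 − p̂_n)))⁻¹| ≤ z} → gaussianReal 0 1 (Icc (−z) z)`.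
§3 **`CrooksPair.ncmc_dFocc_coverage_gamma_of_sq`** — Crooks pair, level samplers invariant,
`ε • ν ≤ nHit Q 2 z` (`ε ≠ 0`), `e^{−ΔF} = Z₁/Z₀`, `τ_int(ρ_occ) > 0`, windows as above; for EVERY
initial state `z₀` and `z > 0`:
`P_{δ_{z₀}}{|√n (dF_occ,n − ΔF) · √(p̂_n(1 − p̂_n)/(2 τ̂_n))| ≤ z} → gaussianReal 0 1 (Icc (−z) z)`.

NOT CLAIMED: the automatic window; `τ_int > 0` is ASSUMED (not derived); finite-`n` coverage; any
value of `τ_int`, `ε` or a number of ours.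
-/

namespace Summit.Ventures.LatticeQCDFlow.Exactness.GeneralNCMC

open MeasureTheory ProbabilityTheory Set Filter Finset
open scoped ENNReal NNReal Topology

/-! ## §1 Lemmas -/

section Lemmas

variable {Ω₀ : Type*} [MeasurableSpace Ω₀] {P : Measure Ω₀} [IsFiniteMeasure P]

/-- **Products of sequences converging in probability to constants** converge in probability to the
product of the constants. -/
theorem TendstoInMeasure.mul_const_lim {Y Y' : ℕ → Ω₀ → ℝ} {c c' : ℝ}
    (hY : TendstoInMeasure P Y atTop (fun _ => c)) (hY' : TendstoInMeasure P Y' atTop (fun _ => c'))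
    (hm : ∀ n, Measurable (Y n)) (hm' : ∀ n, Measurable (Y' n)) :
    TendstoInMeasure P (fun n x => Y n x * Y' n x) atTop (fun _ => c * c') := by
  refine (exists_seq_tendstoInMeasure_atTop_iff (f := fun n x => Y n x * Y' n x)
    (fun n => ((hm n).mul (hm' n)).aestronglyMeasurable)).2 fun ns hns => ?_
  obtain ⟨ns₁, hns₁, h₁⟩ := (hY.comp hns.tendsto_atTop).exists_seq_tendsto_ae
  obtain ⟨ns₂, hns₂, h₂⟩ :=
    (hY'.comp (hns.tendsto_atTop.comp hns₁.tendsto_atTop)).exists_seq_tendsto_ae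
  refine ⟨ns₁ ∘ ns₂, hns₁.comp hns₂, ?_⟩
  filter_upwards [h₁, h₂] with x hx1 hx2
  exact (hx1.comp hns₂.tendsto_atTop).mul hx2

/-- **For an indicator series, scorer A's `Γ̂_N(0)` IS `p̂_N(1 − p̂_N)`** (`p̂_N` the frequency). -/
theorem gammaHat_zero_indicator {S : Type*} (A : Set S) (x : ℕ → S) (N : ℕ) :
    Scoring.gammaHat (fun i => A.indicator (1 : S → ℝ) (x i)) N 0
      = (∑ i ∈ range N, A.indicator (1 : S → ℝ) (x i)) / N
        * (1 - (∑ i ∈ range N, A.indicator (1 : S → ℝ) (x i)) / N) := by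
  rcases Nat.eq_zero_or_pos N with hN | hN
  · subst hN
    unfold Scoring.gammaHat Scoring.acovSum Scoring.lagSum
    simp
  have hN' : (N : ℝ) ≠ 0 := by exact_mod_cast hN.ne'
  have hsq : ∀ i, A.indicator (1 : S → ℝ) (x i) ^ 2 = A.indicator (1 : S → ℝ) (x i) := by
    intro i
    by_cases hi : x i ∈ A
    · simp [Set.indicator_of_mem hi]
    · simp [Set.indicator_of_notMem hi]
  rw [Scoring.gammaHat_zero]
  unfold Scoring.acovSum Scoring.dev Scoring.sampleMean
  rw [Scoring.lagSum_zero]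
  set Sm := ∑ i ∈ range N, A.indicator (1 : S → ℝ) (x i) with hSm
  have hexp : ∑ i ∈ range N, (A.indicator (1 : S → ℝ) (x i) - Sm / N) ^ 2
      = Sm - 2 * (Sm / N) * Sm + N * (Sm / N) ^ 2 := by
    have hpt : ∀ i ∈ range N, (A.indicator (1 : S → ℝ) (x i) - Sm / N) ^ 2
        = A.indicator (1 : S → ℝ) (x i) - 2 * (Sm / N) * A.indicator (1 : S → ℝ) (x i)
          + (Sm / N) ^ 2 := by
      intro i _
      rw [sub_sq, hsq i]
      ring
    rw [Finset.sum_congr rfl hpt, Finset.sum_add_distrib, Finset.sum_sub_distrib, ← Finset.mul_sum,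
      Finset.sum_const, Finset.card_range, nsmul_eq_mul, ← hSm]
  rw [hexp]
  field_simp
  ring

/-- `a · (√(a t))⁻¹ = √(a/t)` for `a ≥ 0` and every real `t` (both sides vanish when `t ≤ 0`). -/
theorem mul_inv_sqrt_mul_eq_sqrt_div {a t : ℝ} (ha : 0 ≤ a) :
    a * (Real.sqrt (a * t))⁻¹ = Real.sqrt (a / t) := by
  rcases le_or_gt t 0 with ht | ht
  · rw [Real.sqrt_eq_zero'.2 (mul_nonpos_of_nonneg_of_nonpos ha ht),
      Real.sqrt_eq_zero'.2 (div_nonpos_of_nonneg_of_nonpos ha ht), inv_zero, mul_zero]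
  rcases ha.eq_or_lt with ha0 | ha0
  · rw [← ha0]; simp
  have hsa : 0 < Real.sqrt a := Real.sqrt_pos.2 ha0
  have hsqt : 0 < Real.sqrt t := Real.sqrt_pos.2 ht
  rw [← div_eq_mul_inv, Real.sqrt_div' a ht.le, Real.sqrt_mul ha t,
    div_eq_div_iff (mul_pos hsa hsqt).ne' hsqt.ne', ← mul_assoc, Real.mul_self_sqrt ha]

/-- The printed `τ̂_{N,W}` of `f ∘ X` is a measurable function of the path. -/
theorem measurable_tauIntWindow_rhoHat {S : Type*} [MeasurableSpace S] {f : S → ℝ}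
    (hf : Measurable f) (N W : ℕ) :
    Measurable fun x : ℕ → S => Scoring.tauIntWindow (Scoring.rhoHat (fun i => f (x i)) N) W := by
  unfold Scoring.tauIntWindow Scoring.rhoHat
  exact measurable_const.add (Finset.measurable_sum _ fun t _ =>
    (measurable_gammaHat_comp hf N (t + 1)).div (measurable_gammaHat_comp hf N 0))

end Lemmas

/-! ## §2 Event frequencies under a Doeblin power -/

section Event

variable {S : Type*} [MeasurableSpace S]
  {κ : Kernel S S} [IsMarkovKernel κ] {π : Measure S} [IsProbabilityMeasure π]
  {ν : Measure S} [IsProbabilityMeasure ν] {ε : ℝ≥0∞} {m : ℕ}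

/-- **EXACT ASYMPTOTIC COVERAGE OF THE FREQUENCY INTERVAL WITH THE Γ-METHOD `τ̂`.**  `κ` Markov,
`π` invariant, `(nHit κ m)(z,·) ≥ ε ν` (`ε ≠ 0`, `0 < m`), `A` measurable with `0 < π(A) < 1` and
`τ_int = Scoring.tauInt (setACF κ π A) > 0`; windows `W_n → ∞`, `W_n³/n → 0`; `z > 0`.  For EVERY
initial law `μ₀`, with `p̂_n` the frequency of `A` and `τ̂_n = tauIntWindow (rhoHat (1_A ∘ X) n) (W n)`:
`P_{μ₀}{|√n (p̂_n − π(A)) · (√(2 τ̂_n p̂_n(1 − p̂_n)))⁻¹| ≤ z} → gaussianReal 0 1 (Icc (−z) z)`. -/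
theorem tendsto_measure_standardizedIndicator_gamma_le_of_nHit (hπ : Kernel.Invariant κ π)
    (hε : ε ≠ 0) (hmin : ∀ z, ε • ν ≤ nHit κ m z) (hm : 0 < m)
    {A : Set S} (hA : MeasurableSet A) (h0 : 0 < π.real A) (h1 : π.real A < 1)
    (hτ : 0 < Scoring.tauInt (setACF κ π A))
    {W : ℕ → ℕ} (hW : Tendsto W atTop atTop) (hW3 : Tendsto (fun N => (W N : ℝ) ^ 3 / N) atTop (𝓝 0))
    (μ₀ : Measure S) [IsProbabilityMeasure μ₀] {z : ℝ} (hz : 0 < z)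
    [IsProbabilityMeasure (Kernel.trajMeasure (X := fun _ : ℕ => S) μ₀
        (fun n : ℕ => κ.comap (fun hh : (i : ↥(Finset.Iic n)) → S => hh ⟨n, Finset.mem_Iic.2 le_rfl⟩)
          (measurable_pi_apply _)))] :
    Tendsto (fun n : ℕ => (Kernel.trajMeasure (X := fun _ : ℕ => S) μ₀
        (fun n : ℕ => κ.comap (fun hh : (i : ↥(Finset.Iic n)) → S => hh ⟨n, Finset.mem_Iic.2 le_rfl⟩)
          (measurable_pi_apply _)))
        {x : ℕ → S | |Real.sqrt n * ((∑ t ∈ range n, A.indicator (1 : S → ℝ) (x t)) / n - π.real A)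
          * (Real.sqrt (2 * Scoring.tauIntWindow
              (Scoring.rhoHat (fun i => A.indicator (1 : S → ℝ) (x i)) n) (W n)
            * ((∑ t ∈ range n, A.indicator (1 : S → ℝ) (x t)) / n
            * (1 - (∑ t ∈ range n, A.indicator (1 : S → ℝ) (x t)) / n))))⁻¹| ≤ z})
      atTop (𝓝 (gaussianReal 0 1 (Icc (-z) z))) := by
  have hf : Measurable (A.indicator (1 : S → ℝ)) := measurable_one.indicator hA
  have hC : ∀ y, |A.indicator (1 : S → ℝ) y| ≤ 1 := fun y => by
    by_cases hy : y ∈ A <;> simp [hy]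
  have hmean : ∫ z, A.indicator (1 : S → ℝ) z ∂π = π.real A := integral_indicator_one hA
  -- the Green–Kubo variance of the indicator is positive
  have hσ : 0 < Scoring.autocov κ π (fun y => A.indicator (1 : S → ℝ) y - ∫ z, A.indicator 1 z ∂π) 0
      + 2 * ∑' t, Scoring.autocov κ π
        (fun y => A.indicator (1 : S → ℝ) y - ∫ z, A.indicator 1 z ∂π) (t + 1) := by
    rw [← cltVariance_eq_autocov κ π, greenKubo_indicator_eq_tauInt hπ hA h0 h1]
    exact mul_pos (mul_pos two_pos hτ) (mul_pos h0 (sub_pos.2 h1))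
  have h := tendsto_measure_studentized_timeAverage_le_of_nHit μ₀ hπ hε hmin hm hf hC hσ hW hW3 hz
  rw [hmean] at h
  refine h.congr' (Eventually.of_forall fun n => ?_)
  congr 1
  ext x
  simp only [Set.mem_setOf_eq]
  -- the two statistics coincide on every path
  have hstat : ((Real.sqrt n)⁻¹ * ∑ t ∈ range n, (A.indicator (1 : S → ℝ) (x t) - π.real A))
        * (Real.sqrt (Scoring.gammaHat (fun i => A.indicator (1 : S → ℝ) (x i)) n 0
          * (2 * Scoring.tauIntWindow
            (Scoring.rhoHat (fun i => A.indicator (1 : S → ℝ) (x i)) n) (W n))))⁻¹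
      = Real.sqrt n * ((∑ t ∈ range n, A.indicator (1 : S → ℝ) (x t)) / n - π.real A)
        * (Real.sqrt (2 * Scoring.tauIntWindow
            (Scoring.rhoHat (fun i => A.indicator (1 : S → ℝ) (x i)) n) (W n)
          * ((∑ t ∈ range n, A.indicator (1 : S → ℝ) (x t)) / n
          * (1 - (∑ t ∈ range n, A.indicator (1 : S → ℝ) (x t)) / n))))⁻¹ := by
    rw [gammaHat_zero_indicator]
    rcases Nat.eq_zero_or_pos n with hn | hn
    · subst hn; simp
    · have hn' : (0 : ℝ) < n := by exact_mod_cast hn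
      have hsq : Real.sqrt n ≠ 0 := (Real.sqrt_pos.2 hn').ne'
      congr 1
      · rw [Finset.sum_sub_distrib, Finset.sum_const, Finset.card_range, nsmul_eq_mul]
        field_simp
        rw [Real.sq_sqrt hn'.le]
      · ring_nf
  rw [hstat]

end Event

/-! ## §3 The NCMC lane: `dF_occ` with the Γ-method `τ̂` of the occupancy series -/

section NCMC

variable {Ω E : Type*} [MeasurableSpace Ω] [MeasurableSpace E]
  {ν₀ ν₁ : Measure Ω} [IsFiniteMeasure ν₀] [IsFiniteMeasure ν₁]
  {κF κR : Kernel Ω E} [IsMarkovKernel κF] [IsMarkovKernel κR] {s e : E → Ω} {W : E → ℝ} {c : ℝ}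
  {T₀ T₁ : Kernel Ω Ω} [IsMarkovKernel T₀] [IsMarkovKernel T₁] {ε : ℝ≥0∞}
  {ν : Measure (Bool × Ω)} [IsProbabilityMeasure ν]

/-- **EXACT ASYMPTOTIC COVERAGE OF THE REPORTED `dF_occ` INTERVAL WITH THE Γ-METHOD `τ̂`, FROM EVERY
INITIAL STATE.**  Crooks pair, level samplers leaving `ν₀, ν₁` invariant, two-step certificate
`ε • ν ≤ (nHit Q 2)(z, ·)` (`ε ≠ 0`), `e^{−ΔF} = Z₁/Z₀`, `τ_int(ρ_occ) > 0`
(`ρ_occ = setACF Q π_c target`); windows `W_n → ∞`, `W_n³/n → 0`; `τ̂_n = tauIntWindow ρ̂_n (W_n)` the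
Γ-method estimate computed from the run's own occupancy series.  For EVERY initial state `z₀` and
every `z > 0`:
`P_{δ_{z₀}}{|√n (dF_occ,n − ΔF) · √(p̂_n(1 − p̂_n)/(2 τ̂_n))| ≤ z} → gaussianReal 0 1 (Icc (−z) z)`. -/
theorem CrooksPair.ncmc_dFocc_coverage_gamma_of_sq (h : CrooksPair ν₀ ν₁ κF κR s e W)
    (h0 : ν₀ univ ≠ 0) (h1 : ν₁ univ ≠ 0) (hT₀ : Kernel.Invariant T₀ ν₀)
    (hT₁ : Kernel.Invariant T₁ ν₁) (hε : ε ≠ 0)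
    (hD : haveI := isMarkovKernel_switchKernel (κF := κF) (κR := κR) (c := c)
              h.measurable_W h.measurable_s h.measurable_e
      ∀ z, ε • ν ≤ nHit (switchKernel κF κR c W s e ∘ₖ levelKernel T₀ T₁) 2 z)
    {ΔF : ℝ} (hΔF : Real.exp (-ΔF) = ((ν₀ univ)⁻¹ * ν₁ univ).toReal)
    (hτ : haveI := isMarkovKernel_switchKernel (κF := κF) (κR := κR) (c := c)
              h.measurable_W h.measurable_s h.measurable_e
      0 < Scoring.tauInt (setACF (switchKernel κF κR c W s e ∘ₖ levelKernel T₀ T₁)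
        ((jointWeight c ν₀ ν₁ univ)⁻¹ • jointWeight c ν₀ ν₁) (targetLevel Ω)))
    {Wn : ℕ → ℕ} (hW : Tendsto Wn atTop atTop) (hW3 : Tendsto (fun N => (Wn N : ℝ) ^ 3 / N) atTop (𝓝 0))
    (z₀ : Bool × Ω) {z : ℝ} (hz : 0 < z)
    [hP : haveI := isMarkovKernel_switchKernel (κF := κF) (κR := κR) (c := c)
              h.measurable_W h.measurable_s h.measurable_e
      haveI := isMarkovKernel_levelKernel T₀ T₁
      IsProbabilityMeasure (Kernel.trajMeasure (X := fun _ : ℕ => Bool × Ω) (Measure.dirac z₀)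
        (fun n : ℕ => (switchKernel κF κR c W s e ∘ₖ levelKernel T₀ T₁).comap
          (fun hh : (j : ↥(Finset.Iic n)) → Bool × Ω => hh ⟨n, Finset.mem_Iic.2 le_rfl⟩)
          (measurable_pi_apply _)))] :
    haveI := isMarkovKernel_switchKernel (κF := κF) (κR := κR) (c := c)
      h.measurable_W h.measurable_s h.measurable_e
    haveI := isMarkovKernel_levelKernel T₀ T₁
    Tendsto (fun n : ℕ => (Kernel.trajMeasure (X := fun _ : ℕ => Bool × Ω) (Measure.dirac z₀)
        (fun n : ℕ => (switchKernel κF κR c W s e ∘ₖ levelKernel T₀ T₁).comap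
          (fun hh : (j : ↥(Finset.Iic n)) → Bool × Ω => hh ⟨n, Finset.mem_Iic.2 le_rfl⟩)
          (measurable_pi_apply _)))
        {x : ℕ → Bool × Ω | |Real.sqrt n * ((c - Real.log
            ((∑ i ∈ range n, (targetLevel Ω).indicator (1 : Bool × Ω → ℝ) (x i)) / n /
              (1 - (∑ i ∈ range n, (targetLevel Ω).indicator (1 : Bool × Ω → ℝ) (x i)) / n)))
            - ΔF)
          * Real.sqrt ((∑ i ∈ range n, (targetLevel Ω).indicator (1 : Bool × Ω → ℝ) (x i)) / n
            * (1 - (∑ i ∈ range n, (targetLevel Ω).indicator (1 : Bool × Ω → ℝ) (x i)) / n)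
            / (2 * Scoring.tauIntWindow (Scoring.rhoHat
              (fun i => (targetLevel Ω).indicator (1 : Bool × Ω → ℝ) (x i)) n) (Wn n)))| ≤ z})
      atTop (𝓝 (gaussianReal 0 1 (Icc (-z) z))) := by
  haveI := isMarkovKernel_switchKernel (κF := κF) (κR := κR) (c := c)
    h.measurable_W h.measurable_s h.measurable_e
  haveI := isMarkovKernel_levelKernel T₀ T₁
  haveI := isProbabilityMeasure_jointLaw c ν₀ ν₁ h0
  set Q := switchKernel κF κR c W s e ∘ₖ levelKernel T₀ T₁ with hQ
  set πc : Measure (Bool × Ω) := (jointWeight c ν₀ ν₁ univ)⁻¹ • jointWeight c ν₀ ν₁ with hπc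
  set P := Kernel.trajMeasure (X := fun _ : ℕ => Bool × Ω) (Measure.dirac z₀)
    (fun n : ℕ => Q.comap (fun hh : (j : ↥(Finset.Iic n)) → Bool × Ω => hh ⟨n, Finset.mem_Iic.2 le_rfl⟩)
      (measurable_pi_apply _)) with hPdef
  set τ : ℝ := Scoring.tauInt (setACF Q πc (targetLevel Ω)) with hτdef
  set σ : ℝ := Real.sigmoid (c - ΔF) with hσdef
  have hσ0 : 0 < σ := Real.sigmoid_pos _
  have hσ1 : σ < 1 := Real.sigmoid_lt_one _
  have hv0 : 0 < σ * (1 - σ) := mul_pos hσ0 (sub_pos.2 hσ1)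
  have hπ : Kernel.Invariant Q πc := invariant_smul _ (iteration_invariant h hT₀ hT₁ c) _
  have hσeq : πc.real (targetLevel Ω) = σ := jointLaw_real_targetLevel c ν₀ ν₁ h0 h1 hΔF
  have hp0 : 0 < πc.real (targetLevel Ω) := by rw [hσeq]; exact hσ0
  have hp1 : πc.real (targetLevel Ω) < 1 := by rw [hσeq]; exact hσ1
  -- the occupancy indicator
  have hg : Measurable ((targetLevel Ω).indicator (1 : Bool × Ω → ℝ)) :=
    measurable_one.indicator measurableSet_targetLevel
  have hgb : ∀ y, |(targetLevel Ω).indicator (1 : Bool × Ω → ℝ) y| ≤ 1 := fun y => by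
    by_cases hy : y ∈ targetLevel Ω <;> simp [hy]
  -- its Green–Kubo variance is `2 τ σ(1 − σ) > 0`
  have hvar : Scoring.autocov Q πc (fun y => (targetLevel Ω).indicator (1 : Bool × Ω → ℝ) y
        - ∫ z, (targetLevel Ω).indicator 1 z ∂πc) 0
      + 2 * ∑' t, Scoring.autocov Q πc (fun y => (targetLevel Ω).indicator (1 : Bool × Ω → ℝ) y
        - ∫ z, (targetLevel Ω).indicator 1 z ∂πc) (t + 1) = 2 * τ * (σ * (1 - σ)) := by
    rw [← cltVariance_eq_autocov Q πc, greenKubo_indicator_eq_tauInt hπ measurableSet_targetLevel hp0 hp1,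
      hσeq]
  have hσpos : 0 < Scoring.autocov Q πc (fun y => (targetLevel Ω).indicator (1 : Bool × Ω → ℝ) y
        - ∫ z, (targetLevel Ω).indicator 1 z ∂πc) 0
      + 2 * ∑' t, Scoring.autocov Q πc (fun y => (targetLevel Ω).indicator (1 : Bool × Ω → ℝ) y
        - ∫ z, (targetLevel Ω).indicator 1 z ∂πc) (t + 1) := by
    rw [hvar]; positivity
  -- the `dF_occ` CLT with the canonical Gaussian variable
  have hclt := h.ncmc_dFocc_clt_of_sq h0 h1 hT₀ hT₁ hε hD hΔF z₀
    (P' := gaussianReal 0 (Real.toNNReal (2 * τ / (σ * (1 - σ))))) (Y := id) HasLaw.id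
  -- plug-in factors: `p̂(1 − p̂) → σ(1 − σ)` a.s., `(√(Γ̂(0)·2τ̂))⁻¹ → (√(2τσ(1−σ)))⁻¹` in probability
  have hpm : ∀ n : ℕ, Measurable fun x : ℕ → Bool × Ω =>
      (∑ i ∈ range n, (targetLevel Ω).indicator (1 : Bool × Ω → ℝ) (x i)) / n := fun n =>
    (Finset.measurable_sum _ fun i _ => hg.comp (measurable_pi_apply i)).div_const _
  have hAm : ∀ n : ℕ, Measurable fun x : ℕ → Bool × Ω =>
      (∑ i ∈ range n, (targetLevel Ω).indicator (1 : Bool × Ω → ℝ) (x i)) / n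
        * (1 - (∑ i ∈ range n, (targetLevel Ω).indicator (1 : Bool × Ω → ℝ) (x i)) / n) := fun n =>
    (hpm n).mul (measurable_const.sub (hpm n))
  have hfreq := h.ncmc_occupancy_everyStart_of_sq h0 h1 hT₀ hT₁ hε hD hΔF z₀
  have hA : TendstoInMeasure P (fun (n : ℕ) (x : ℕ → Bool × Ω) =>
      (∑ i ∈ range n, (targetLevel Ω).indicator (1 : Bool × Ω → ℝ) (x i)) / n
        * (1 - (∑ i ∈ range n, (targetLevel Ω).indicator (1 : Bool × Ω → ℝ) (x i)) / n))
      atTop (fun _ => σ * (1 - σ)) := by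
    refine tendstoInMeasure_of_tendsto_ae (fun n => (hAm n).aestronglyMeasurable) ?_
    filter_upwards [hfreq] with x hx
    exact hx.mul (tendsto_const_nhds.sub hx)
  have hIm : ∀ n : ℕ, Measurable fun x : ℕ → Bool × Ω =>
      (Real.sqrt (Scoring.gammaHat (fun i => (targetLevel Ω).indicator (1 : Bool × Ω → ℝ) (x i)) n 0
        * (2 * Scoring.tauIntWindow (Scoring.rhoHat
          (fun i => (targetLevel Ω).indicator (1 : Bool × Ω → ℝ) (x i)) n) (Wn n))))⁻¹ := fun n =>
    (measurable_gammaWindow hg n (Wn n)).sqrt.inv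
  have hI := chain_invSqrt_gammaWindow_tendstoInMeasure_of_nHit (Measure.dirac z₀) hπ hε hD
    (by norm_num : 0 < 2) hg hgb hσpos hW hW3
  rw [← hPdef, hvar] at hI
  have hB := TendstoInMeasure.mul_const_lim hA hI hAm hIm
  -- the printed scale `√(p̂(1−p̂)/(2τ̂))` equals the product of the two plug-in factors
  have hBm : ∀ n : ℕ, Measurable fun x : ℕ → Bool × Ω =>
      Real.sqrt ((∑ i ∈ range n, (targetLevel Ω).indicator (1 : Bool × Ω → ℝ) (x i)) / n
        * (1 - (∑ i ∈ range n, (targetLevel Ω).indicator (1 : Bool × Ω → ℝ) (x i)) / n)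
        / (2 * Scoring.tauIntWindow (Scoring.rhoHat
          (fun i => (targetLevel Ω).indicator (1 : Bool × Ω → ℝ) (x i)) n) (Wn n))) := fun n =>
    ((hAm n).div (measurable_const.mul (measurable_tauIntWindow_rhoHat hg n (Wn n)))).sqrt
  have hp01 : ∀ (n : ℕ) (x : ℕ → Bool × Ω),
      0 ≤ (∑ i ∈ range n, (targetLevel Ω).indicator (1 : Bool × Ω → ℝ) (x i)) / n
        * (1 - (∑ i ∈ range n, (targetLevel Ω).indicator (1 : Bool × Ω → ℝ) (x i)) / n) := by
    intro n x
    have hs0 : 0 ≤ ∑ i ∈ range n, (targetLevel Ω).indicator (1 : Bool × Ω → ℝ) (x i) :=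
      Finset.sum_nonneg fun i _ => Set.indicator_nonneg (fun _ _ => zero_le_one) _
    have hs1 : ∑ i ∈ range n, (targetLevel Ω).indicator (1 : Bool × Ω → ℝ) (x i) ≤ n := by
      calc ∑ i ∈ range n, (targetLevel Ω).indicator (1 : Bool × Ω → ℝ) (x i)
          ≤ ∑ i ∈ range n, (1 : ℝ) := Finset.sum_le_sum fun i _ =>
            Set.indicator_le_self' (fun _ _ => zero_le_one) _
        _ = n := by simp
    rcases Nat.eq_zero_or_pos n with hn | hn
    · subst hn; simp
    · have hn' : (0 : ℝ) < n := by exact_mod_cast hn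
      exact mul_nonneg (div_nonneg hs0 hn'.le)
        (sub_nonneg.2 ((div_le_one hn').2 hs1))
  have hfunB : (fun (n : ℕ) (x : ℕ → Bool × Ω) =>
      Real.sqrt ((∑ i ∈ range n, (targetLevel Ω).indicator (1 : Bool × Ω → ℝ) (x i)) / n
        * (1 - (∑ i ∈ range n, (targetLevel Ω).indicator (1 : Bool × Ω → ℝ) (x i)) / n)
        / (2 * Scoring.tauIntWindow (Scoring.rhoHat
          (fun i => (targetLevel Ω).indicator (1 : Bool × Ω → ℝ) (x i)) n) (Wn n))))
      = fun (n : ℕ) (x : ℕ → Bool × Ω) =>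
        (∑ i ∈ range n, (targetLevel Ω).indicator (1 : Bool × Ω → ℝ) (x i)) / n
          * (1 - (∑ i ∈ range n, (targetLevel Ω).indicator (1 : Bool × Ω → ℝ) (x i)) / n)
        * (Real.sqrt (Scoring.gammaHat (fun i => (targetLevel Ω).indicator (1 : Bool × Ω → ℝ) (x i)) n 0
          * (2 * Scoring.tauIntWindow (Scoring.rhoHat
            (fun i => (targetLevel Ω).indicator (1 : Bool × Ω → ℝ) (x i)) n) (Wn n))))⁻¹ := by
    funext n x
    rw [gammaHat_zero_indicator, mul_inv_sqrt_mul_eq_sqrt_div (hp01 n x)]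
  have hB' : TendstoInMeasure P (fun (n : ℕ) (x : ℕ → Bool × Ω) =>
      Real.sqrt ((∑ i ∈ range n, (targetLevel Ω).indicator (1 : Bool × Ω → ℝ) (x i)) / n
        * (1 - (∑ i ∈ range n, (targetLevel Ω).indicator (1 : Bool × Ω → ℝ) (x i)) / n)
        / (2 * Scoring.tauIntWindow (Scoring.rhoHat
          (fun i => (targetLevel Ω).indicator (1 : Bool × Ω → ℝ) (x i)) n) (Wn n))))
      atTop (fun _ => σ * (1 - σ) * (Real.sqrt (2 * τ * (σ * (1 - σ))))⁻¹) := by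
    rw [hfunB]; exact hB
  have hcov := tendsto_measure_abs_mul_le_of_clt_of_tendstoInMeasure hBm HasLaw.id hclt hB' hz
  -- the limit variance is one
  have hnn : NNReal.mk ((σ * (1 - σ) * (Real.sqrt (2 * τ * (σ * (1 - σ))))⁻¹) ^ 2) (sq_nonneg _)
      * (2 * τ / (σ * (1 - σ))).toNNReal = 1 := by
    apply NNReal.eq
    have h2 : σ ≠ 0 := hσ0.ne'
    have h3 : 1 - σ ≠ 0 := (sub_pos.2 hσ1).ne'
    have h4 : τ ≠ 0 := hτ.ne'
    rw [NNReal.coe_mul, NNReal.coe_mk, Real.coe_toNNReal _ (by positivity), NNReal.coe_one, mul_pow,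
      inv_pow, Real.sq_sqrt (by positivity)]
    field_simp
  rw [hnn] at hcov
  exact hcov

end NCMC

end Summit.Ventures.LatticeQCDFlow.Exactness.GeneralNCMC
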